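import Summits.RiemannHypothesis.RiemannHypothesis.Theorems.WeilColumnThetaMellin
import Summits.RiemannHypothesis.RiemannHypothesis.Theorems.WeilColumnThetaMellinTransform
import Literature.NumberTheory.LFunctions.GeneralizedRH
import HarnessLib

/-!
# CAPSTONE of (Z1)+(Z4a): the odd theta profile `G₀⁻` has Weil–Mellin transform ZERO at every nontrivial zero of `ζ` (RH-FREE)

WEIL column (LADDER-RH, W-P(P2); crux `ThetaCertificateSound`). For a Lipschitz profile `G` supported in `[c₁, c₂] ⊂ (0, ∞)` with
`∫ G = 0`, `Θ_G = Σ_{n≥1} G(n·)` and `G₀(x) = e^{x/2}Θ_G(eˣ)`: `weilMellin (G₀ − G₀(−·)) ρ = 0` at every `ρ` with `ζ(ρ) = 0`,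
`0 < Re ρ < 1` — from `Theorems/WeilColumnThetaMellin.lean` (p411028: `mellin Θ_G` vanishes at `ρ` and, by
`GeneralizedRH.riemannZeta_one_sub_eq_zero`, at `1 − ρ`) and `Theorems/WeilColumnThetaMellinTransform.lean` (`weilMellin_oddProfile_eq_zero`).
This is the input «ĝ⁻(ρ) = −T̂⁻(ρ)» of the zero-side theta certificate (cc-s2-3 WEIL-THEORY-R3 §3′). Nothing here bears on the truth of RH.
-/

set_option linter.dupNamespace false

noncomputable section

open MeasureTheory Set Complex
open Literature.NumberTheory.LFunctions

namespace Summit.RiemannHypothesis.RiemannHypothesis.Theorems.WeilColumn.ThetaMellin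

variable {G : ℝ → ℂ} {c₁ c₂ : ℝ}

/-- The theta series of a compactly supported profile bounded near `0` is Mellin-summable on `Re s > 0`. [folklore] -/
theorem ProfileHyp.mellinConvergent_thetaSum (hG : ProfileHyp G c₁ c₂) (hb : ThetaBoundedNearZero G) {z : ℂ}
    (hz : 0 < z.re) : MellinConvergent (thetaSum G) z :=
  mellinConvergent_of_isBigO_rpow hG.locallyIntegrableOn_thetaSum (hG.thetaSum_isBigO_atTop (z.re + 1)) (by linarith)
    (thetaSum_isBigO_nhdsGT_of_bounded hb) (by simpa using hz)

/-- **CAPSTONE (Z1 + Z4a): the ODD THETA PROFILE `G₀⁻` of PART XIX has Weil–Mellin transform ZERO at every nontrivial zero of `ζ`.**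
For a Lipschitz profile `G` supported in `[c₁, c₂] ⊂ (0,∞)` with `∫ G = 0` and `G₀(x) = e^{x/2} Θ_G(eˣ)`:
`weilMellin (G₀ − G₀(−·)) ρ = 0` whenever `ζ(ρ) = 0`, `0 < Re ρ < 1`. RH-free. [this seat, R3 §3′ (Z1)/(Z4a)] -/
theorem ProfileHyp.weilMellin_oddProfile_thetaSum_eq_zero (hG : ProfileHyp G c₁ c₂) {L : ℝ} (hL0 : 0 ≤ L)
    (hL : ∀ x y : ℝ, ‖G x - G y‖ ≤ L * |x - y|) (hint : ∫ x, G x = 0)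
    {ρ : ℂ} (hζ : riemannZeta ρ = 0) (h0 : 0 < ρ.re) (h1 : ρ.re < 1) :
    weilMellin (oddProfile (thetaSum G)) ρ = 0 := by
  have hb := hG.thetaBoundedNearZero hL0 hL hint
  have h0' : 0 < (1 - ρ).re := by simp; linarith
  have h1' : (1 - ρ).re < 1 := by simp; linarith
  have hζ' : riemannZeta (1 - ρ) = 0 := Literature.NumberTheory.LFunctions.GeneralizedRH.riemannZeta_one_sub_eq_zero hζ h0 h1
  exact weilMellin_oddProfile_eq_zero _ (hG.mellinConvergent_thetaSum hb h0) (hG.mellinConvergent_thetaSum hb h0')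
    (hG.mellin_thetaSum_vanishes_at_zeta_zeros hL0 hL hint hζ h0 h1)
    (hG.mellin_thetaSum_vanishes_at_zeta_zeros hL0 hL hint hζ' h0' h1')

end Summit.RiemannHypothesis.RiemannHypothesis.Theorems.WeilColumn.ThetaMellin
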